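import Summits.Ventures.PercRepro.S1ChainKill

/-!
# PercRepro — THE CELL FORM'S `Y`-SIDE AND WEIGHTED INEQUALITY FROM AN ABSTRACT KILL (p2, gen 23; SUBCLAIM-S1 §6.8)

The two consumers of S1KillCells / S1NullityCells with the kill credit `A′` and the overlap `B′` as plain numbers:
any inequality of the `midCount_ge_K7_kill_*` shape (`7560·(Σ_{j=5}^{p−1} C(n, j) + A′) ≤ 7560·#Y + R₃ + R₄ + 7560·B′`)
feeds `cellYsum_kill_le_abs`, and any `Y`-side inequality `cellYsum + 7560·A′ ≤ 7560·#Y + cellR34 + 7560·B′` feeds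
`weighted_of_killnullOK_abs` — so a new kill needs no copy of the arithmetic.
Axioms: standard.
-/

open scoped Matroid

namespace PercRepro

namespace S1

open Set

variable {α : Type}

/-- `cellYsum_kill_le` from an abstract kill inequality: `7560·(Σ_{j=5}^{p−1} C(n, j) + A′) ≤ 7560·#Y + R₃ + R₄ + 7560·B′`
(the `midCount_ge_K7_kill_*` shape) gives `cellYsum + 7560·A′ ≤ 7560·#Y + cellR34 + 7560·B′`. -/
theorem cellYsum_kill_le_abs (M : Matroid α) [M.Finite] (p d P S S5 : ℕ) (hd4 : 4 ≤ d) (hR : M.eRank = (p : ℕ∞))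
    (hn : M.E.ncard = p + d)
    (hfree : ∀ e ∈ M.E, ∃ A ⊆ M.E \ {e}, e ∉ M.closure A ∧ e ∉ M.closure ((M.E \ {e}) \ A))
    (hP : {C : Set α | M.IsCircuit C ∧ C.ncard = 3}.ncard ≤ P) (hS : {C : Set α | M.IsCircuit C ∧ C.ncard = 4}.ncard ≤ S)
    (hS5 : {C : Set α | M.IsCircuit C ∧ C.ncard = 5}.ncard ≤ S5) (A' B' : ℕ)
    (hY : 7560 * (∑ j ∈ Finset.Ico 5 p, M.E.ncard.choose j + A') ≤
      7560 * Matroid.midCount M p 4 +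
      10584 * ({C : Set α | M.IsCircuit C ∧ C.ncard = 3}.ncard * (M.E.ncard - 3) +
        {C : Set α | M.IsCircuit C ∧ C.ncard = 4}.ncard) +
      (RSK 10 * ({C : Set α | M.IsCircuit C ∧ C.ncard = 3}.ncard * (M.E.ncard - 3).choose 2 +
        {C : Set α | M.IsCircuit C ∧ C.ncard = 4}.ncard * (M.E.ncard - 4) +
        {C : Set α | M.IsCircuit C ∧ C.ncard = 5}.ncard) +
      (RBK 10 - RSK 10) * ({C : Set α | M.IsCircuit C ∧ C.ncard = 3}.ncard * (min (5 * d) M.E.ncard - 3).choose 2 +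
        {C : Set α | M.IsCircuit C ∧ C.ncard = 4}.ncard * (min (5 * d) M.E.ncard - 4) +
        {C : Set α | M.IsCircuit C ∧ C.ncard = 5}.ncard)) + 7560 * B') :
    cellYsum p d + 7560 * A' ≤ 7560 * Matroid.midCount M p 4 + cellR34 p d P S S5 + 7560 * B' := by
  unfold cellR34 cellYsum
  simp only [CoreRegimes.chooseF_eq]
  classical
  have hL : ∀ e ∈ M.E, ¬ M.IsLoop e := ThmN.not_isLoop_of_free M hfree
  have hs : ∀ e ∈ M.E, ∀ f ∈ M.E, e ≠ f → M.eRk {e, f} = 2 := by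
    intro e he f hf hef
    have h2 : (2 : ℕ∞) ≤ M.eRk {e, f} :=
      ThmN.two_le_eRk_of_two_le_ncard_of_free M hfree (pair_subset he hf) (by rw [ncard_pair hef])
    have h3 : M.eRk {e, f} ≤ 2 := by
      have := M.eRk_le_encard {e, f}
      rwa [encard_pair hef] at this
    exact le_antisymm h3 h2
  have hcirc : ∀ C, M.IsCircuit C → 3 ≤ C.encard := ThmN.three_le_encard_of_circuit M hL hs
  have hline : ∀ L ⊆ M.E, M.eRk L ≤ 2 → L.ncard ≤ 3 := by
    intro L hL' hr
    have := ThmN.ncard_add_one_le_two_pow_of_eRk_le M hL hfree 2 L hL' hr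
    omega
  have hplane : ∀ P ⊆ M.E, M.eRk P ≤ 3 → P.ncard ≤ 6 := fun P hP hr =>
    ThmN.ncard_le_six_of_eRk_le_three_of_free M hfree hP hr
  have hten : ∀ X ⊆ M.E, M.eRk X ≤ 4 → X.ncard ≤ 10 := fun X hX hr =>
    ThmN.ncard_le_ten_of_eRk_le_four_of_free M hfree hX hr
  have hd : M.E.encard = M.eRank + d := by
    rw [hR, ← M.ground_finite.cast_ncard_eq, hn]
    push_cast
    ring
  set s3 := {C : Set α | M.IsCircuit C ∧ C.ncard = 3}.ncard with hs3
  set s4 := {C : Set α | M.IsCircuit C ∧ C.ncard = 4}.ncard with hs4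
  set s5 := {C : Set α | M.IsCircuit C ∧ C.ncard = 5}.ncard with hs5
  have hb3 : s3 ≤ min (min (d * (d + 1) / 2) ((d * d + 6 - 3 * d) / 2)) P := by
    have h := two_mul_ncard_triangles_le M (fun L hL hr => hline L hL hr.le) hd
    have h' : 2 * s3 ≤ d * (d + 1) := h
    have h2 := two_mul_ncard_triangles_add_three_mul_le_of_four_le M
      (fun L hL hr => hline L hL hr.le) hplane hd4 hd
    have h2' : 2 * s3 + 3 * d ≤ d * d + 6 := h2
    refine le_min (le_min ?_ ?_) hP
    · rw [Nat.le_div_iff_mul_le (by norm_num)]; omega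
    · rw [Nat.le_div_iff_mul_le (by norm_num)]; omega
  have hb4 : s4 ≤ min (min (min ((d + 3).choose 4) (d * (d + 1) * (d + 2) / 3)) (fourCircuitBound d)) S := by
    refine le_min (le_min (le_min (ncard_circuits_four_le M hd) ?_) (ncard_fourCircuits_le_fourCircuitBound M hfree hd)) hS
    have h := three_mul_ncard_four_circuits_le M hline hplane hd
    have h' : 3 * s4 ≤ d * (d + 1) * (d + 2) := h
    rw [Nat.le_div_iff_mul_le (by norm_num)]
    omega
  have hb5 : s5 ≤ min ((d + 4).choose 5) S5 := le_min (ncard_circuits_five_le M hd) hS5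
  rw [hn] at hY
  set m := min (5 * d) (p + d) with hm
  set s3B := min (min (d * (d + 1) / 2) ((d * d + 6 - 3 * d) / 2)) P with hs3B
  set s4B := min (min (min ((d + 3).choose 4) (d * (d + 1) * (d + 2) / 3)) (fourCircuitBound d)) S with hs4B
  set s5B := min ((d + 4).choose 5) S5 with hs5B
  set piAll := s3 * (p + d - 3).choose 2 + s4 * (p + d - 4) + s5 with hpiAll
  set piS0 := s3 * (m - 3).choose 2 + s4 * (m - 4) + s5 with hpiS0
  set piAllB := s3B * (p + d - 3).choose 2 + s4B * (p + d - 4) + s5B with hpiAllB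
  set piS0B := s3B * (m - 3).choose 2 + s4B * (m - 4) + s5B with hpiS0B
  have hpiAll_le : piAll ≤ piAllB := by
    rw [hpiAll, hpiAllB]; gcongr
  have hpiS0_le : piS0 ≤ piS0B := by
    rw [hpiS0, hpiS0B]; gcongr
  have hR3_le : 10584 * (s3 * (p + d - 3) + s4) ≤ 10584 * (s3B * (p + d - 3) + s4B) := by
    gcongr
  have hR4_le : RSK 10 * piAll + (RBK 10 - RSK 10) * piS0 ≤ RSK 10 * piAllB + (RBK 10 - RSK 10) * piS0B := by
    gcongr
  have hY' : 7560 * (∑ j ∈ Finset.Ico 5 p, (p + d).choose j + A') ≤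
      7560 * Matroid.midCount M p 4 + 10584 * (s3 * (p + d - 3) + s4) +
      (RSK 10 * piAll + (RBK 10 - RSK 10) * piS0) + 7560 * B' := hY
  omega



/-- `weighted_of_killnullOK` from an abstract `Y`-side inequality `cellYsum + 7560·A′ ≤ 7560·#Y + cellR34 + 7560·B′`. -/
theorem weighted_of_killnullOK_abs (N : Matroid α) [N.Finite] (p0 p d P S S5 A B X : ℕ) (hd4 : 4 ≤ d)
    (hR : N.eRank = (p : ℕ∞)) (hn : N.E.ncard = p + d)
    (hfree : ∀ e ∈ N.E, ∃ Z ⊆ N.E \ {e}, e ∉ N.closure Z ∧ e ∉ N.closure ((N.E \ {e}) \ Z))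
    (hP : {C : Set α | N.IsCircuit C ∧ C.ncard = 3}.ncard ≤ P) (hS : {C : Set α | N.IsCircuit C ∧ C.ncard = 4}.ncard ≤ S)
    (hS5 : {C : Set α | N.IsCircuit C ∧ C.ncard = 5}.ncard ≤ S5)
    (hp : 5 ≤ p) (hp0 : 5 ≤ p0) (A' B' : ℕ)
    (hYB : cellYsum p d + 7560 * A' ≤ 7560 * Matroid.midCount N p 4 + cellR34 p d P S S5 + 7560 * B')
    {Sn : Set α} (hSn : Sn ⊆ N.E) {r kk : ℕ} (hν : N.eRk Sn + (r : ℕ∞) ≤ (Sn.ncard : ℕ∞)) (hkk : d + 1 ≤ kk + r)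
    (hX : X ≤ {B : Set α | B ⊆ N.E ∧ B.ncard = 4 ∧ N.eRk B = 4 ∧ kk ≤ (B \ Sn).ncard}.ncard)
    (hok : killnullOK p0 p d P S S5 (A + A') (B + B') X = true) :
    phiK p0 4 * (Matroid.topCount N p 4 : ℚ) + B ≤ (Matroid.midCount N p 4 : ℚ) + A := by
  have hd : N.E.encard = N.eRank + d := by
    rw [hR, ← N.ground_finite.cast_ncard_eq, hn]
    push_cast
    ring
  have hlevel := levelCount_le_cellUB N p d P S S5 hd4 hR hn hfree hP hS hS5 hp
  have hexcl := topCount_add_excl_le N hR hd hn hd4 hSn hν hkk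
  unfold killnullOK at hok
  simp only [CoreRegimes.chooseF_eq] at hok
  have hok' := of_decide_eq_true hok
  set phiNum := 2 ^ (p0 + 4) - 2 * ∑ u ∈ Finset.range 5, (p0 + 4).choose u with hphiNum
  set phiDen := (p0 + 4).choose 4 with hphiDen
  set UB := cellUB p d P S S5
  set R34 := cellR34 p d P S S5
  set Ysum := cellYsum p d
  set T := Matroid.topCount N p 4
  set Y := Matroid.midCount N p 4
  set Z := {B : Set α | B ⊆ N.E ∧ B.ncard = 4 ∧ N.eRk B = 4 ∧ kk ≤ (B \ Sn).ncard}.ncard with hZ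
  set L := {B : Set α | B ⊆ N.E ∧ N.eRk B = 4 ∧ B.ncard ≤ d}.ncard with hL
  set KA := A' with hKA
  set KB := B' with hKB
  -- `7560·T + 7560·X ≤ UB`
  have hUX : 7560 * T + 7560 * X ≤ UB := by
    have h1 : T + X ≤ L := by omega
    calc 7560 * T + 7560 * X = 7560 * (T + X) := by ring
      _ ≤ 7560 * L := Nat.mul_le_mul_left _ h1
      _ ≤ UB := hlevel
  have h1 : phiNum * (7560 * T) + phiNum * (7560 * X) ≤ phiNum * UB := by
    calc phiNum * (7560 * T) + phiNum * (7560 * X) = phiNum * (7560 * T + 7560 * X) := by ring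
      _ ≤ phiNum * UB := Nat.mul_le_mul_left _ hUX
  have h2 : phiDen * (Ysum + 7560 * KA) ≤ phiDen * (7560 * Y + R34 + 7560 * KB) := Nat.mul_le_mul_left _ hYB
  have hchain : phiNum * (7560 * T) + phiDen * (7560 * B) ≤ phiDen * (7560 * Y) + phiDen * (7560 * A) := by
    have e1 : phiDen * (R34 + 7560 * (B + KB)) = phiDen * R34 + phiDen * (7560 * B) + phiDen * (7560 * KB) := by ring
    have e2 : phiDen * (Ysum + 7560 * (A + KA)) = phiDen * Ysum + phiDen * (7560 * A) + phiDen * (7560 * KA) := by ring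
    have e3 : phiDen * (7560 * Y + R34 + 7560 * KB) = phiDen * (7560 * Y) + phiDen * R34 + phiDen * (7560 * KB) := by
      ring
    have e4 : phiDen * (Ysum + 7560 * KA) = phiDen * Ysum + phiDen * (7560 * KA) := by ring
    rw [e1, e2] at hok'
    rw [e3, e4] at h2
    omega
  -- to `ℚ`
  have hsum : 2 * ∑ u ∈ Finset.range 5, (p0 + 4).choose u ≤ 2 ^ (p0 + 4) := by
    have := sum_Ioo_choose_add_four p0 hp0
    omega
  have hphiNumQ : (phiNum : ℚ) = 2 ^ (p0 + 4) - 2 * ∑ u ∈ Finset.range 5, ((p0 + 4).choose u : ℚ) := by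
    rw [hphiNum, Nat.cast_sub hsum]
    push_cast
    ring
  have hΦ := phiK_four_mul_choose_eq p0 hp0
  rw [← hphiNumQ] at hΦ
  have hDenPos : (0 : ℚ) < (phiDen : ℚ) := by
    rw [hphiDen]; exact_mod_cast Nat.choose_pos (by omega)
  have hchainQ : (phiNum : ℚ) * (7560 * (T : ℚ)) + (phiDen : ℚ) * (7560 * (B : ℚ)) ≤
      (phiDen : ℚ) * (7560 * (Y : ℚ)) + (phiDen : ℚ) * (7560 * (A : ℚ)) := by
    have h : ((phiNum * (7560 * T) + phiDen * (7560 * B) : ℕ) : ℚ) ≤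
        ((phiDen * (7560 * Y) + phiDen * (7560 * A) : ℕ) : ℚ) := by exact_mod_cast hchain
    push_cast at h
    linarith
  have hkey : (phiK p0 4 * (T : ℚ) + (B : ℚ)) * (phiDen : ℚ) ≤ ((Y : ℚ) + (A : ℚ)) * (phiDen : ℚ) := by
    have e : (phiK p0 4 * (T : ℚ) + (B : ℚ)) * (phiDen : ℚ) =
        (phiK p0 4 * (phiDen : ℚ)) * (T : ℚ) + (phiDen : ℚ) * (B : ℚ) := by ring
    rw [e, hphiDen, hΦ, ← hphiDen]
    nlinarith [hchainQ]
  exact le_of_mul_le_mul_right hkey hDenPos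



end S1

end PercRepro
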